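import Summits.HubbardSuperconductivity.HubbardSuperconductivity.Theorems.ThermalWedgeTwSeededEnsembleEquivalenceRColdDiffUniqSmall

/-!
# Crux `TwSeededEnsembleEquivalenceR` (stmt-HubbardSuperconductivity-15581), line `cold-floor-collapse`
# (slug `Sketch`) — GLUE: S4a from FLOOR + DEEP-DIFF + DEEP-UNIQ′

Support file (`--supports stmt-HubbardSuperconductivity-15581`; sorry-free; no definition). Skeleton v6
restricts the two physics inputs of the cold slice `β = e^{a/U}` to DEEP sources `e^{−a/(4U)} ≤ |h| ≤ 13g+1`:

* DEEP-DIFF: `μ ↦ q(μ,h)` is differentiable at interior `μ` for every deep `h` in the box;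
* DEEP-UNIQ′: at interior `μ` the DEEP maximisers of `h ↦ q(μ,h) − h²/g` over `|h| ≤ 13g+1` lie in `{h*, −h*}`;

and adds the FLOOR: every maximiser over the box is deep. This file re-glues the three into S4a (the common
`μ`-slope of all maximisers, verbatim the conclusion of `sourcedColdDiffUniq_of_diff_uniqSmall`): take the
common exponent `a := min a₀ (min a₁ a₂)` (each datum holds for every smaller positive exponent), the seed floor
`K' := max` and `U₀ := min` of the three data; a maximiser is deep by the FLOOR, hence `±h*` by DEEP-UNIQ′, and
DEEP-DIFF at `h*` (deep since `|−h*| = |h*|`) gives the derivative, transferred to `−h*` by gauge evenness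
(`partitionFn_dWaveSourceTorus_neg` passes to the pointwise limits, so `q(·,−h*) = q(·,h*)` near `μ`).
[folklore composition]
-/

set_option linter.dupNamespace false

namespace Summit.HubbardSuperconductivity.HubbardSuperconductivity.Theorems.TwSeededEnsembleEquivalenceR.ColdFloorLine

open Matrix Filter Topology Finset Literature.MathematicalPhysics.QuantumLattice
open Summit.HubbardSuperconductivity.HubbardSuperconductivity.Theorems.TwSourcedCondensation.Negative
open scoped ComplexOrder

noncomputable section

/-- **GLUE (S4a from FLOOR + DEEP-DIFF + DEEP-UNIQ′).** With `a := min a₀ (min a₁ a₂)`, `K' := max` and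
`U₀ := min` of the three data at that `a`: at an interior `μ` let `h*` be the modulus of DEEP-UNIQ′ and
`d := deriv (q · h*) μ`; a maximiser `h` over the box is deep (FLOOR), hence `h = h*` or `h = −h*` (DEEP-UNIQ′);
in either case `h*` is deep (`|−h*| = |h*|`), so `q(·,h*)` has derivative `d` at `μ` (DEEP-DIFF), and
`q(·,−h*) = q(·,h*)` on the window (evenness of the finite-volume sourced pressures passes to the pointwise
limits), so `q(·,−h*)` has derivative `d` too. [folklore composition] -/
theorem stub_deepGlue :
    (∀ (μ₁ μ₂ : ℝ), -4 < μ₁ → μ₁ < μ₂ → μ₂ < 0 → ∃ a₂ : ℝ, 0 < a₂ ∧ ∀ a ∈ Set.Ioc (0 : ℝ) a₂,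
      ∃ K' U₀ : ℝ, 0 < K' ∧ 0 < U₀ ∧ ∀ U ∈ Set.Ioc (0 : ℝ) U₀, ∀ g ∈ Set.Icc (K' * U) (1 / 10),
        ∀ q : ℝ → ℝ → ℝ,
          (∀ μ ∈ Set.Icc μ₁ μ₂, ∀ h ∈ Set.Icc (-(13 * g + 1)) (13 * g + 1), ∀ κ : ℝ, 0 < κ →
            ∃ L₀ : ℕ, ∀ (L : ℕ) [NeZero L], L₀ ≤ L →
              |Real.log (Matrix.partitionFn (Real.exp (a / U)) (dWaveSourceTorus L U μ h)).re /
                  (Real.exp (a / U) * (L : ℝ) ^ 2) - q μ h| ≤ κ) →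
          ∀ μ ∈ Set.Icc μ₁ μ₂, ∀ h ∈ Set.Icc (-(13 * g + 1)) (13 * g + 1),
            q μ h - h ^ 2 / g =
                sSup ((fun h' : ℝ => q μ h' - h' ^ 2 / g) '' Set.Icc (-(13 * g + 1)) (13 * g + 1)) →
              Real.exp (-(a / (4 * U))) ≤ |h|) →
    (∀ (μ₁ μ₂ : ℝ), -4 < μ₁ → μ₁ < μ₂ → μ₂ < 0 → ∃ a₀ : ℝ, 0 < a₀ ∧ ∀ a ∈ Set.Ioc (0 : ℝ) a₀,
      ∃ K' U₀ : ℝ, 0 < K' ∧ 0 < U₀ ∧ ∀ U ∈ Set.Ioc (0 : ℝ) U₀, ∀ g ∈ Set.Icc (K' * U) (1 / 10),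
        ∀ q : ℝ → ℝ → ℝ,
          (∀ μ ∈ Set.Icc μ₁ μ₂, ∀ h ∈ Set.Icc (-(13 * g + 1)) (13 * g + 1), ∀ κ : ℝ, 0 < κ →
            ∃ L₀ : ℕ, ∀ (L : ℕ) [NeZero L], L₀ ≤ L →
              |Real.log (Matrix.partitionFn (Real.exp (a / U)) (dWaveSourceTorus L U μ h)).re /
                  (Real.exp (a / U) * (L : ℝ) ^ 2) - q μ h| ≤ κ) →
          ∀ μ ∈ Set.Ioo μ₁ μ₂, ∀ h ∈ Set.Icc (-(13 * g + 1)) (13 * g + 1),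
            Real.exp (-(a / (4 * U))) ≤ |h| → DifferentiableAt ℝ (fun μ' => q μ' h) μ) →
    (∀ (μ₁ μ₂ : ℝ), -4 < μ₁ → μ₁ < μ₂ → μ₂ < 0 → ∃ a₁ : ℝ, 0 < a₁ ∧ ∀ a ∈ Set.Ioc (0 : ℝ) a₁,
      ∃ K' U₀ : ℝ, 0 < K' ∧ 0 < U₀ ∧ ∀ U ∈ Set.Ioc (0 : ℝ) U₀, ∀ g ∈ Set.Icc (K' * U) (1 / 10),
        ∀ q : ℝ → ℝ → ℝ,
          (∀ μ ∈ Set.Icc μ₁ μ₂, ∀ h ∈ Set.Icc (-(13 * g + 1)) (13 * g + 1), ∀ κ : ℝ, 0 < κ →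
            ∃ L₀ : ℕ, ∀ (L : ℕ) [NeZero L], L₀ ≤ L →
              |Real.log (Matrix.partitionFn (Real.exp (a / U)) (dWaveSourceTorus L U μ h)).re /
                  (Real.exp (a / U) * (L : ℝ) ^ 2) - q μ h| ≤ κ) →
          ∀ μ ∈ Set.Ioo μ₁ μ₂, ∃ hstar : ℝ, ∀ h ∈ Set.Icc (-(13 * g + 1)) (13 * g + 1),
            Real.exp (-(a / (4 * U))) ≤ |h| →
            q μ h - h ^ 2 / g =
                sSup ((fun h' : ℝ => q μ h' - h' ^ 2 / g) '' Set.Icc (-(13 * g + 1)) (13 * g + 1)) →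
              h = hstar ∨ h = -hstar) →
    ∀ (μ₁ μ₂ : ℝ), -4 < μ₁ → μ₁ < μ₂ → μ₂ < 0 → ∃ a K' U₀ : ℝ, 0 < a ∧ 0 < K' ∧ 0 < U₀ ∧
      ∀ U ∈ Set.Ioc (0 : ℝ) U₀, ∀ g ∈ Set.Icc (K' * U) (1 / 10), ∀ q : ℝ → ℝ → ℝ,
        (∀ μ ∈ Set.Icc μ₁ μ₂, ∀ h ∈ Set.Icc (-(13 * g + 1)) (13 * g + 1), ∀ κ : ℝ, 0 < κ →
            ∃ L₀ : ℕ, ∀ (L : ℕ) [NeZero L], L₀ ≤ L →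
              |Real.log (Matrix.partitionFn (Real.exp (a / U)) (dWaveSourceTorus L U μ h)).re /
                  (Real.exp (a / U) * (L : ℝ) ^ 2) - q μ h| ≤ κ) →
        ∀ μ ∈ Set.Ioo μ₁ μ₂, ∃ d : ℝ, ∀ h ∈ Set.Icc (-(13 * g + 1)) (13 * g + 1),
          q μ h - h ^ 2 / g =
              sSup ((fun h' : ℝ => q μ h' - h' ^ 2 / g) '' Set.Icc (-(13 * g + 1)) (13 * g + 1)) →
            HasDerivAt (fun μ' => q μ' h) d μ := by
  -- adapted from `sourcedColdDiffUniq_of_diff_uniqSmall` (…RColdDiffUniqSmall.lean)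
  intro hF hD hUq μ₁ μ₂ h1 h12 h2
  obtain ⟨a₂, ha₂, hFa⟩ := hF μ₁ μ₂ h1 h12 h2
  obtain ⟨a₀, ha₀, hDa⟩ := hD μ₁ μ₂ h1 h12 h2
  obtain ⟨a₁, ha₁, hUa⟩ := hUq μ₁ μ₂ h1 h12 h2
  set a : ℝ := min a₀ (min a₁ a₂)
  have ha : 0 < a := lt_min ha₀ (lt_min ha₁ ha₂)
  have haa₀ : a ≤ a₀ := min_le_left _ _
  have haa₁ : a ≤ a₁ := (min_le_right _ _).trans (min_le_left _ _)
  have haa₂ : a ≤ a₂ := (min_le_right _ _).trans (min_le_right _ _)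
  obtain ⟨KF, UF, hKF, hUF, hFmain⟩ := hFa a ⟨ha, haa₂⟩
  obtain ⟨KD, UD, hKD, hUD, hDmain⟩ := hDa a ⟨ha, haa₀⟩
  obtain ⟨KU, UU, hKU, hUU, hUmain⟩ := hUa a ⟨ha, haa₁⟩
  refine ⟨a, max KF (max KD KU), min UF (min UD UU), ha, lt_max_of_lt_left hKF,
    lt_min hUF (lt_min hUD hUU), ?_⟩
  intro U hU g hg q hq μ hμ
  have hUF' : U ∈ Set.Ioc (0 : ℝ) UF := ⟨hU.1, hU.2.trans (min_le_left _ _)⟩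
  have hUD' : U ∈ Set.Ioc (0 : ℝ) UD :=
    ⟨hU.1, hU.2.trans ((min_le_right _ _).trans (min_le_left _ _))⟩
  have hUU' : U ∈ Set.Ioc (0 : ℝ) UU :=
    ⟨hU.1, hU.2.trans ((min_le_right _ _).trans (min_le_right _ _))⟩
  have hgF : g ∈ Set.Icc (KF * U) (1 / 10) :=
    ⟨le_trans (mul_le_mul_of_nonneg_right (le_max_left _ _) hU.1.le) hg.1, hg.2⟩
  have hgD : g ∈ Set.Icc (KD * U) (1 / 10) :=
    ⟨le_trans (mul_le_mul_of_nonneg_right ((le_max_left _ _).trans (le_max_right _ _)) hU.1.le) hg.1,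
      hg.2⟩
  have hgU : g ∈ Set.Icc (KU * U) (1 / 10) :=
    ⟨le_trans (mul_le_mul_of_nonneg_right ((le_max_right _ _).trans (le_max_right _ _)) hU.1.le) hg.1,
      hg.2⟩
  set β : ℝ := Real.exp (a / U)
  have hμ' : μ ∈ Set.Icc μ₁ μ₂ := ⟨hμ.1.le, hμ.2.le⟩
  obtain ⟨hstar, hst⟩ := hUmain U hUU' g hgU q hq μ hμ
  -- evenness of `q` in `h` on the window (limits of even finite-volume pressures)
  have heven : ∀ μ' ∈ Set.Icc μ₁ μ₂, ∀ h ∈ Set.Icc (-(13 * g + 1)) (13 * g + 1),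
      q μ' (-h) = q μ' h := by
    intro μ' hμ' h hh
    have hnh : -h ∈ Set.Icc (-(13 * g + 1)) (13 * g + 1) := ⟨by linarith [hh.2], by linarith [hh.1]⟩
    have hseq : ∀ h₁ ∈ Set.Icc (-(13 * g + 1)) (13 * g + 1), ∀ κ : ℝ, 0 < κ → ∃ N : ℕ, ∀ n, N ≤ n →
        |Real.log (partitionFn β (dWaveSourceTorus (n + 1) U μ' h₁)).re / (β * (((n + 1 : ℕ) : ℝ)) ^ 2) -
          q μ' h₁| ≤ κ := by
      intro h₁ hh₁ κ hκ
      obtain ⟨L₀, hL₀⟩ := hq μ' hμ' h₁ hh₁ κ hκ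
      exact ⟨L₀, fun n hn => hL₀ (n + 1) (by omega)⟩
    have h0 : |q μ' (-h) - q μ' h| ≤ 0 := by
      refine cfb_abs_sub_le_of_limits (hseq (-h) hnh) (hseq h hh) fun n => ?_
      rw [partitionFn_dWaveSourceTorus_neg, sub_self, abs_zero]
    have h00 : |q μ' (-h) - q μ' h| = 0 := le_antisymm h0 (abs_nonneg _)
    rw [abs_eq_zero, sub_eq_zero] at h00
    exact h00
  refine ⟨deriv (fun μ' => q μ' hstar) μ, fun h hh hmax => ?_⟩
  -- FLOOR: the maximiser `h` is deep
  have hdeep : Real.exp (-(a / (4 * U))) ≤ |h| := hFmain U hUF' g hgF q hq μ hμ' h hh hmax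
  rcases hst h hh hdeep hmax with rfl | rfl
  · exact (hDmain U hUD' g hgD q hq μ hμ _ hh hdeep).hasDerivAt
  · -- `h = -hstar`: `hstar` is deep too; use evenness near `μ`
    have hh' : hstar ∈ Set.Icc (-(13 * g + 1)) (13 * g + 1) := ⟨by linarith [hh.2], by linarith [hh.1]⟩
    have hdeep' : Real.exp (-(a / (4 * U))) ≤ |hstar| := by rwa [abs_neg] at hdeep
    have hder : HasDerivAt (fun μ' => q μ' hstar) (deriv (fun μ' => q μ' hstar) μ) μ :=
      (hDmain U hUD' g hgD q hq μ hμ hstar hh' hdeep').hasDerivAt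
    refine hder.congr_of_eventuallyEq ?_
    filter_upwards [Icc_mem_nhds hμ.1 hμ.2] with μ' hμ'
    exact heven μ' hμ' hstar hh'

end

end Summit.HubbardSuperconductivity.HubbardSuperconductivity.Theorems.TwSeededEnsembleEquivalenceR.ColdFloorLine
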